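import Literature.MathematicalPhysics.QuantumFieldTheory.Balaban1983to89.B9Cor36CubeKernelComparison
import Literature.MathematicalPhysics.QuantumFieldTheory.Balaban1983to89.B9Cor36CubeCutoffs
import Literature.MathematicalPhysics.QuantumFieldTheory.Balaban1983to89.B9Thm39CinvAtCover
import Literature.MathematicalPhysics.QuantumFieldTheory.Balaban1983to89.B6BlockCutoffKLevelV1

/-!
# `Balaban1983to89.B9Cor36CubeTwinsGeometry` — THE GEOMETRY OF THE C-JUNCTION AT ONE COVER CUBE □: THE TWIN SET `S_□` OF `supp h_□`, THE TRUNCATION SET `N_□`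
# (cube blocks with corner within `3S_j − L^{j+1}` of the centre), THEIR TWIN ∕ PLATEAU ∕ SUPPORT FACTS, THE WALK LEMMA OF THE CUBE SEQUENCE AND THE SEPARATION
# `M_h ≤ d_□(S_□, 𝔅_□ ∖ N_□)`, AND THE TRANSPORTER AGREEMENT ON `N_□` FROM THE (3.35) DATUM — the located inputs `N, S, hN, hh, hχ, hχt, hagree, hDN, hDχ` of
# FILES E2-1 ∕ E2-3a ∕ E2-5b-1 for the record's cut-offs (sub-row G-B9-LETTERS, module M5.2-E, FILE E2-5b-2; design (β) of `lit-balaban-p21/M52E-DESIGN-p21.md`)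

T. Bałaban, *Propagators for lattice gauge theories in a background field*, Commun. Math. Phys. **99** (1985) 389–434
[`Balaban1985BackgroundPropagators`, "B9"]; [4] = T. Bałaban, *Propagators and renormalization transformations for lattice gauge
theories. II*, Commun. Math. Phys. **96** (1984) 223–250 [`Balaban1984PropagatorsII`]; [4-I] = part I, CMP **95** (1984) 17–40 [`Balaban1984PropagatorsI`].

statement-level skeleton of published theorems with citation tags; proofs where landed; nothing here is a claim about the
Yang–Mills mass gap

THE PRINTED LOCUS (verbatim, held `paper:balaban1985-cmp99-background-propagators`, journal page = PDF page + 388).  p. 408 l. 26–44 (the cubes `□̃ⁿ` *«of the size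
(2 + 2n)MLʲη»* and the sequence `{Ω_n(□)}_{n=0,…,j+1}`, *«Ω_j(□) = □̃⁴»*); p. 409 l. 1–5, (3.87)–(3.89); p. 410 l. 14–15 (*«G′_□ depends on U restricted to Ω₀(□) ⊂ □̃⁵»*); p. 411
(3.95) and l. 12–14 (*«the supports of h_□ and of 1 − □̃ are separated at least by a distance MLʲη (if □ ∈ 𝒟_j), so the part of the exponential factor can be estimated by
e^{−¼δ₀M}»*); p. 412 l. 31–36 (*«exp(−δM)»*); [4] (2.45)–(2.46) p. 231 (admissible bonds and contours, `d(y, y′)`), (2.82)–(2.83) p. 237, (2.36) p. 229.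

WHY THIS FILE (cell `lit-balaban`; M5.2-E E2-5 = the per-cube supplier of p21's M5.6 defect edition `B9Thm39CinvAtCoverLargeDefect.cinv_cover_large_defect`).  FILE E2-1
(`B9Cor36CinvCubeLocLetter`) proved the local-inverse law of the C-junction letter for ANY truncation set `N` of common blocks with `supp h_□ ⊂ J(N)`, `χ_□ = 1` on the
`N`-blocks and transporter agreement on `N`; FILE E2-3a ∕ E2-5b-1 majorise the defect given a set `S ⊆ N` carrying `supp h_□` and SEPARATIONS `D_N ≦ d_□(S, ∁N)`,
`D_χ ≦ d_□(S, Z_χ)` in the cube sequence's (2.46) distance.  THIS FILE FIXES the record's sets and proves every located input for the cut-offs of record (p33's FILE 4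
`B9Cor36CubeCutoffs`: `χ_□ = 1` within `3S_j`, `χ̃_□ = 1` within `3.75S_j`, `S_j = M_h·L^{j+1}`) and the block cover of record (`B6Cover236MultiLevelTorusBlocks.hB`):
* §1 `bS = L^{j+1}`; `twinS` (`S_□` := the cube blocks that are twins of member blocks with `h_□ ≠ 0`); `nearN` (`N_□` := the cube blocks whose corner is within
  `3S_j − L^{j+1}` of the centre of `β`);
* §2 block arithmetic of `{Ω_n(□)}` (all levels `≤ j + 1`: `level_le`, `pow_level_le_bS`, `abs_sub_corner_le`, `nearC_of_blkCubeY_eq`, `nearC_corner_of_nearC`, `SC_eq`,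
  `eight_mul_bS_le_SC` — `M_h ≥ 8` in the V1 family);
* §3 ★ `val_mem_of_mem_nearN` (`N_□` ⊂ twins — r05's `coarsen_blkOf_val_of_nearH` + p33's `nearH_of_nearC`), ★ `exists_twinS_of_hB_ne_zero` (`supp h_□ ⊂ J(S_□)`),
  ★ `twinS_subset_nearN`, `nearC_of_blkCubeY_mem_nearN`, ★ `chiY_eq_one_of_mem_nearN`, `chiBigT_mul_hB` (`1_{□̃}h_□ = h_□`), `abs_hB_le`, and the `Z_χ := 𝔅_□ ∖ N_□` forms;
* §4 ★★ THE WALK LEMMA `dist_T(pos s, pos y) ≦ d_□(s, y)·L^{j+1}` (`dist_posT_le_length_mul`, `dist_posT_le_dist_mul`: a bond of the cube sequence joins blocks of level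
  `≤ j + 1`, whose positions are at most `L^{j+1}` apart — N03's `dist_posT_le_of_adj`), `torusSupNorm_le_dist_posT_add`, ★ `sub_le_dist_mul_of_nearC`
  (`r₂ − r₁ − L^{j+1} + 2 ≦ d_□·L^{j+1}` for a block with a site within `r₁` and a block with a site outside `r₂`), ★★ `Mh_le_dist_of_mem_twinS` (`M_h ≦ d_□(s, y)` for
  `s ∈ S_□`, `y ∉ N_□` — print's «separated at least by a distance MLʲη» for the record's sets; exactly `2M_h − 2 + 2L^{−(j+1)} ≦ d_□`), `Mh_eq_DsepT` (`M_h = 2L·D_sep` in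
  M5.6's currency);
* §5 ★ `agreeNearY_of_nearC` (p33's `agreeNearY_DthY_of_near` with a FREE row set within `3S_j − L^{j+1}`, the block-mate radius sharpened from `S_j` to `L^{j+1}` by
  `levY_le_succ_of_nearC`), `agreeNearY_locCfgY_of_nearC`, ★★ `parSymY_agree_of_mem_nearN` (E2-1's binder `hagree` on `N_□` at `parSymY`, from `U^u = e^{iηA}` on the bonds
  of `Q ⊇ NearC(3S_j + 2)`).

HONEST SCOPE.  Integer ∕ torus bookkeeping over r05's, p33's, N03's and def-Y's DEFINED objects; no inequality of the papers beyond the combinatorial separation count.  The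
sets `S_□`, `N_□` and the radius `3S_j − L^{j+1}` are the (R)-design's choices (GAPS.md G-B9-p21-01: print's `C_□` needs no truncation); the separation constant `M_h`
(print: `MLʲη` in length units = `M` blocks of level `j`; here `≥ M_h = M/L` cube-distance units, the walk lemma charging every bond the maximal side `L^{j+1}`) is
ours and only its positivity ∕ linearity in `M` is used downstream.  Count-neutral; no summit ∕ sub-problem statement is proved; nothing continuum ∕ OS ∕ mass-gap ∕ Clay.
No `sorry`, no `axiom`, no `… : Prop` fact, no `instance`, no `notation`; three small `def`s with bodies (`bS`, `twinS`, `nearN`).  NEW file; nothing landed is modified.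
Cell `lit-balaban`, seat `lit-balaban-p21` gen 35, 2026-08-28; `--supports stmt-QuantumFields-19200` as helper.  Net new unproved facts: 0.

RELATED IN THE TREE, NOT DUPLICATED (searched 2026-08-28: `lean search 'twinS|nearN|dist_posT_le_length' --decl` = ∅): p33 `B9Cor36CubeCutoffs` (`SC`, `NearC`, `chiY`, `chiTY`,
`locCfgY`, `DthY`-based agreement — USED; §5 generalises its row set), r05 `B9CubeCoarsening` (`coarsen_blkOf_val_of_nearH`, `dist_coarsen_le`), `B9CubeSequence408` (`NearH`,
`sI`, `ctrC`), N03 `B6Geom246MultiLevelTorusL0` (`bondT`, `posT`, `dist_posT_le_of_adj`, `walk_dispT` — the level-crossing walk form; ours is the bounded-level form),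
`B6Geom246MultiLevelTorus` (`toT`, `dist_toT_toR`), `B6BlockCutoffKLevelV1.circAbs_le_torusSupNorm'` (reused after a `dedup.landed` dry-run), p21 E2-1 (`blkOf_eq_iff_of_val_eq`, `parS_agree_of_agreeNearY`), E2-5a `B9Cor36CubeKernelComparison`, gen-33 FILE 10
`B9Thm39CinvAtCover` (`chiBigT`, `DsepT`, member-side `hsep_cover` via `gap_QT`), def-Y `Node00.OpsYLocalInverseAgree` — no existing module modified.
-/

noncomputable section

namespace Literature.MathematicalPhysics.QuantumFieldTheory.Balaban1983to89.B9Cor36CubeTwinsGeometry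

open B6KLevelCensusIndexV1 (KIdx kGeo)
open B6Cover236MultiLevelBlocks (cubes)
open B6Cover236MultiLevelTorusBlocks (hB rep blkOf_rep mem_QT_of_hB_ne_zero abs_hB_le_one)
open B6Geom246MultiLevelBox (bset blkOf toR)
open B6Partition118KLevelTorusCentral (QT QbigT QT_subset_QbigT)
open B6MultiLevelBoxOperator (bigSide)
open B6MultiLevelTorusOperator (one_le_of_mem)
open B4TorusKernel.MultiPeriod (circAbs torusSupNorm circAbs_le_abs circAbs_nonneg)
open B4Sect5Torus (circAbs_add_le circAbs_neg)
open B6Geom246MultiLevelTorus (TPt toT dist_toT_toR)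
open B6Geom246MultiLevelTorusL0 (bondT posT dist_posT_le_of_adj dist_site_posT_le connectedT)
open B9CubeSequence408 (NearH sI)
open B9CubeLettersOpsL0 (cubeFamY oddMh two_le_R levCubeY)
open B9CubeLettersBondOpsL0 (BlkCubeY blkCornerCubeY)
open B9Eq360DeltaPrimeACubeY (blkCubeY blkCubeY_apply)
open B9CubeCoarsening (coarsen_blkOf_val_of_nearH)
open B9CubeGeometryInputs (geoCK geoCK_dist)
open B9GeoLemma21KLevelV1 (one_le_Mh)
open B9Thm37CubeCoverCommutatorSizes (side_conditions four_le_P')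
open B9Thm39CinvAtCover (chiBigT DsepT)
open B9Cor36CinvCubeLocLetter (blkOf_eq_iff_of_val_eq)
open B9Cor36CubeCutoffs (SC NearC nearC_of_hT_ne_zero nearH_of_nearC levY_le_succ_of_nearC chiY chiY_eq_one_of_nearC one_le_SC nine_le_SC
  nearC_shiftY_symm nearC_of_blkOf_eq levY_eq_of_blkOf_eq chiTY chiTY_eq_one_of_nearC locCfgY locCfgY_apply fluct_cutFldY_of_eq_one)
open Node00 (SiteY BlkY CfgY GaugeY toKT levY parSymY gaugeY)
open Node00.OpsYLocalInverseAgree (AgreeNearY taxiBondsY parLocalY_parSymY)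

variable {d ℓ : ℕ} {hd : 1 ≤ d + 1} {hL : Odd (ℓ + 1) ∧ 1 < ℓ + 1} {b₀ b₁ : ℝ}
variable (i : KIdx d ℓ hd hL b₀ b₁) (c : ↥(cubes (toKT i).D.toDomains))

/-! ## §1 The two sets of cube blocks: `S_□` (twins of `supp h_□`) and `N_□` (blocks with corner within `3S_j − L^{j+1}` of the centre) -/

/-- `L^{j+1}`, the largest block side of the cube sequence `{Ω_n(□)}_{n ≤ j+1}` in lattice units. [cite: Balaban1985BackgroundPropagators, p.408 («{Ω_n(□)}_{n=0,…,j+1}»), dictionary] -/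
def bS : ℕ := (ℓ + 1) ^ (c.1.1 + 1)

open Classical in
/-- **`S_□`: THE CUBE BLOCKS THAT ARE TWINS OF THE MEMBER BLOCKS MEETING `supp h_□`** (same `(level, label)` pair, `h_□` read at the block).
[cite: Balaban1985BackgroundPropagators, (3.87) p.409, p.408 l.36–44; Balaban1984PropagatorsII, (2.82) p.237 («y″ ∈ supp h_□′»), dictionary] -/
def twinS : Finset (BlkCubeY i c) := Finset.univ.filter fun s => ∃ hs : s.1 ∈ bset i.D.toDomains, hB i.D c ⟨s.1, hs⟩ ≠ 0

open Classical in
/-- **`N_□`: THE CUBE BLOCKS WHOSE CORNER IS WITHIN `3S_j − L^{j+1}` OF THE CENTRE OF `β`** (so that all their sites lie within `3S_j`, where `χ_□ = 1` and the two block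
structures coincide) — the truncation set of the (R)-design letter `C_□`. [cite: Balaban1985BackgroundPropagators, p.408 (□̃³ ⊂ Ω_j(□) = □̃⁴), p.410 l.14–15, dictionary] -/
def nearN : Finset (BlkCubeY i c) := Finset.univ.filter fun y => NearC i c (3 * SC i c - (bS i c : ℤ)) (blkCornerCubeY i c y).1

/-- membership in `S_□`. [cite: Balaban1985BackgroundPropagators, (3.87) p.409, bookkeeping] -/
theorem mem_twinS {s : BlkCubeY i c} : s ∈ twinS i c ↔ ∃ hs : s.1 ∈ bset i.D.toDomains, hB i.D c ⟨s.1, hs⟩ ≠ 0 := by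
  classical
  simp only [twinS, Finset.mem_filter, Finset.mem_univ, true_and]

/-- membership in `N_□`. [cite: Balaban1985BackgroundPropagators, p.408, bookkeeping] -/
theorem mem_nearN {y : BlkCubeY i c} : y ∈ nearN i c ↔ NearC i c (3 * SC i c - (bS i c : ℤ)) (blkCornerCubeY i c y).1 := by
  classical
  simp only [nearN, Finset.mem_filter, Finset.mem_univ, true_and]

/-! ## §2 Block arithmetic of the cube sequence: sides `≤ L^{j+1} = S_j / M_h` -/

/-- `S_j = M_h·L^{j+1}`. [cite: Balaban1985BackgroundPropagators, p.408; Balaban1984PropagatorsII, (2.1) p.224, bookkeeping] -/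
theorem SC_eq : SC i c = ((toKT i).Mh : ℤ) * (bS i c : ℤ) := by
  show ((bigSide ℓ (toKT i).Mh c.1.1 : ℕ) : ℤ) = _
  unfold bigSide bS
  push_cast
  ring

/-- `1 ≤ L^{j+1}`. [cite: Balaban1984PropagatorsII, (2.1) p.224, bookkeeping] -/
theorem one_le_bS : 1 ≤ bS i c := Nat.one_le_pow _ _ (by omega)

/-- `8·L^{j+1} ≤ S_j` (`M_h ≥ 8` for the V1 family). [cite: Balaban1984PropagatorsII, (2.1) p.224, bookkeeping] -/
theorem eight_mul_bS_le_SC : 8 * (bS i c : ℤ) ≤ SC i c := by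
  rw [SC_eq]
  have h8 : (8 : ℤ) ≤ ((toKT i).Mh : ℤ) := by exact_mod_cast i.hM8
  have hb : (0 : ℤ) ≤ (bS i c : ℤ) := by positivity
  nlinarith

/-- the cube block of the corner of a cube block is that block. [cite: Balaban1984PropagatorsII, (2.1) p.224, bookkeeping] -/
theorem blkCubeY_corner (y : BlkCubeY i c) : blkCubeY i c (blkCornerCubeY i c y) = y :=
  B6Geom246MultiLevelBoxL0.blkOf_corner _ y

/-- every block of the cube sequence has level `≤ j + 1`. [cite: Balaban1985BackgroundPropagators, p.408 («{Ω_n(□)}_{n=0,…,j+1}»)] -/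
theorem level_le (y : BlkCubeY i c) : y.1.1 ≤ c.1.1 + 1 := by
  have h := (B9CubeGeometryInputs.geoCK_len_blkCubeY i c (blkCornerCubeY i c y)).2
  have e : (blkCubeY i c (blkCornerCubeY i c y)).1.1 = levCubeY i c (blkCornerCubeY i c y) :=
    (B6Geom246MultiLevelBoxL0.lev_eq_of_blkOf_eq (cubeFamY i c).toDomains rfl).symm
  rw [blkCubeY_corner] at e
  omega

/-- hence side `L^{n(y)} ≤ L^{j+1}`. [cite: Balaban1984PropagatorsII, (2.1) p.224, bookkeeping] -/
theorem pow_level_le_bS (y : BlkCubeY i c) : (ℓ + 1) ^ y.1.1 ≤ bS i c := Nat.pow_le_pow_right (by omega) (level_le i c y)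

/-- **A SITE OF A CUBE BLOCK IS WITHIN `L^{j+1} − 1` OF THE BLOCK'S CORNER IN EVERY COORDINATE.** [cite: Balaban1984PropagatorsII, (2.1) p.224, bookkeeping] -/
theorem abs_sub_corner_le {z : SiteY i} {y : BlkCubeY i c} (h : blkCubeY i c z = y) (μ : Fin (d + 1)) :
    |z.1 μ - (blkCornerCubeY i c y).1 μ| ≤ (bS i c : ℤ) - 1 := by
  have hb := B6Geom246MultiLevelBoxL0.coord_bounds (cubeFamY i c).toDomains h μ
  have hp : (((ℓ + 1) ^ y.1.1 : ℕ) : ℤ) ≤ (bS i c : ℤ) := by exact_mod_cast pow_level_le_bS i c y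
  show |z.1 μ - (((ℓ + 1) ^ y.1.1 : ℕ) : ℤ) * y.1.2 μ| ≤ _
  rw [abs_le]; constructor <;> linarith [hb.1, hb.2]

/-- a site of a cube block whose corner is within `r` is within `r + (L^{j+1} − 1)`. [cite: Balaban1984PropagatorsII, (2.1) p.224, bookkeeping] -/
theorem nearC_of_blkCubeY_eq {r : ℤ} {z : SiteY i} {y : BlkCubeY i c} (h : blkCubeY i c z = y) (hy : NearC i c r (blkCornerCubeY i c y).1) :
    NearC i c (r + ((bS i c : ℤ) - 1)) z.1 := by
  intro μ
  have hN : 1 ≤ (toKT i).NB μ := one_le_of_mem z.2 μ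
  have t := circAbs_add_le hN ((blkCornerCubeY i c y).1 μ - B9CubeSequence408.ctrC c μ) (z.1 μ - (blkCornerCubeY i c y).1 μ)
  rw [show (blkCornerCubeY i c y).1 μ - B9CubeSequence408.ctrC c μ + (z.1 μ - (blkCornerCubeY i c y).1 μ) = z.1 μ - B9CubeSequence408.ctrC c μ by ring] at t
  exact t.trans (add_le_add (hy μ) ((circAbs_le_abs hN _).trans (abs_sub_corner_le i c h μ)))

/-- conversely the corner of the cube block of a site within `r` is within `r + (L^{j+1} − 1)`. [cite: Balaban1984PropagatorsII, (2.1) p.224, bookkeeping] -/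
theorem nearC_corner_of_nearC {r : ℤ} {z : SiteY i} (hz : NearC i c r z.1) :
    NearC i c (r + ((bS i c : ℤ) - 1)) (blkCornerCubeY i c (blkCubeY i c z)).1 := by
  intro μ
  have hN : 1 ≤ (toKT i).NB μ := one_le_of_mem z.2 μ
  have t := circAbs_add_le hN (z.1 μ - B9CubeSequence408.ctrC c μ) ((blkCornerCubeY i c (blkCubeY i c z)).1 μ - z.1 μ)
  rw [show z.1 μ - B9CubeSequence408.ctrC c μ + ((blkCornerCubeY i c (blkCubeY i c z)).1 μ - z.1 μ) =
    (blkCornerCubeY i c (blkCubeY i c z)).1 μ - B9CubeSequence408.ctrC c μ by ring] at t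
  refine t.trans (add_le_add (hz μ) ((circAbs_le_abs hN _).trans ?_))
  rw [abs_sub_comm]
  exact abs_sub_corner_le i c rfl μ

/-! ## §3 `N_□` consists of twins; `supp h_□ ⊂ J(S_□)`; `S_□ ⊆ N_□`; `χ_□ = 1` on the sites of `N_□`; `χ̃_□·h_□ = h_□` -/

/-- **THE BLOCKS OF `N_□` ARE TWINS** (their corner is near □, where the member's and the cube sequence's block data coincide — r05's `coarsen_blkOf_val_of_nearH`).
[cite: Balaban1985BackgroundPropagators, p.408 (□̃³ ⊂ Ω_j(□) = □̃⁴); Balaban1984PropagatorsII, (2.45) p.231] -/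
theorem val_mem_of_mem_nearN {y : BlkCubeY i c} (hy : y ∈ nearN i c) : y.1 ∈ bset i.D.toDomains := by
  have hc := (mem_nearN i c).1 hy
  have hb : (0 : ℤ) ≤ (bS i c : ℤ) := by positivity
  have hH : NearH c (blkCornerCubeY i c y).1 := nearH_of_nearC i c (by linarith) hc
  have e : (blkOf i.D.toDomains (blkCornerCubeY i c y)).1 = (blkCubeY i c (blkCornerCubeY i c y)).1 :=
    coarsen_blkOf_val_of_nearH (hL := hL.1) (hM := oddMh i) (hMh := (toKT i).hMh) (hP := (toKT i).hP) (two_le_R i) hH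
  rw [blkCubeY_corner] at e
  rw [← e]
  exact (blkOf i.D.toDomains (blkCornerCubeY i c y)).2

/-- **`supp h_□ ⊂ J(S_□)`**: a member block where `h_□ ≠ 0` is the twin of a block of `S_□` (its representative site is within `S_j` of the centre, r05).
[cite: Balaban1985BackgroundPropagators, (3.87) p.409; Balaban1984PropagatorsII, (2.36) p.229, (2.45) p.231] -/
theorem exists_twinS_of_hB_ne_zero {t : BlkY i} (ht : hB i.D c t ≠ 0) : ∃ s ∈ twinS i c, s.1 = t.1 := by
  have hz : B6Partition118KLevelTorus.hT (toKT i).D c (rep i.D.toDomains t) ≠ 0 := ht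
  have hnear := nearC_of_hT_ne_zero i c hz
  have hH : NearH c (rep i.D.toDomains t).1 := nearH_of_nearC i c (by linarith [one_le_SC i c]) hnear
  have e : (blkOf i.D.toDomains (rep i.D.toDomains t)).1 = (blkCubeY i c (rep i.D.toDomains t)).1 :=
    coarsen_blkOf_val_of_nearH (hL := hL.1) (hM := oddMh i) (hMh := (toKT i).hMh) (hP := (toKT i).hP) (two_le_R i) hH
  rw [blkOf_rep] at e
  have h2 : (blkCubeY i c (rep i.D.toDomains t)).1 ∈ bset i.D.toDomains := by rw [← e]; exact t.2
  refine ⟨blkCubeY i c (rep i.D.toDomains t), (mem_twinS i c).2 ⟨h2, ?_⟩, e.symm⟩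
  have hts : (⟨(blkCubeY i c (rep i.D.toDomains t)).1, h2⟩ : BlkY i) = t := Subtype.ext e.symm
  rw [hts]; exact ht

/-- **`S_□ ⊆ N_□`** (the corner of a twin of `supp h_□` is within `S_j + L^{j+1} − 1 ≤ 3S_j − L^{j+1}`). [cite: Balaban1985BackgroundPropagators, (3.87) p.409, p.408; Balaban1984PropagatorsII, (2.36) p.229] -/
theorem twinS_subset_nearN : twinS i c ⊆ nearN i c := by
  intro s hs
  obtain ⟨hs1, hne⟩ := (mem_twinS i c).1 hs
  have hz : B6Partition118KLevelTorus.hT (toKT i).D c (rep i.D.toDomains ⟨s.1, hs1⟩) ≠ 0 := hne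
  have hnear := nearC_of_hT_ne_zero i c hz
  have hblk : blkCubeY i c (rep i.D.toDomains ⟨s.1, hs1⟩) = s :=
    (blkOf_eq_iff_of_val_eq i c (t := ⟨s.1, hs1⟩) (s := s) rfl _).1 (blkOf_rep i.D.toDomains _)
  have h := nearC_corner_of_nearC i c hnear
  rw [hblk] at h
  refine (mem_nearN i c).2 (h.mono i c ?_)
  linarith [eight_mul_bS_le_SC i c]

/-- **THE SITES OF THE BLOCKS OF `N_□` ARE WITHIN `3S_j − 1` OF THE CENTRE.** [cite: Balaban1985BackgroundPropagators, p.408, bookkeeping] -/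
theorem nearC_of_blkCubeY_mem_nearN {z : SiteY i} (h : blkCubeY i c z ∈ nearN i c) : NearC i c (3 * SC i c - 1) z.1 := by
  have h1 := nearC_of_blkCubeY_eq i c rfl ((mem_nearN i c).1 h)
  exact h1.mono i c (by linarith)

/-- **`χ_□ = 1` ON THE SITES OF THE BLOCKS OF `N_□`** (`χ_□ = 1` within `3S_j`, p33 FILE 4). [cite: Balaban1985BackgroundPropagators, Cor. 3.6 p.408, p.410 l.14–15] -/
theorem chiY_eq_one_of_mem_nearN {z : SiteY i} (h : blkCubeY i c z ∈ nearN i c) : chiY i c z = 1 :=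
  chiY_eq_one_of_nearC i c (by linarith) (nearC_of_blkCubeY_mem_nearN i c h)

/-- **`χ̃_□·h_□ = h_□` ON `𝔅`** (`supp h_□ ⊂ □⁺ ⊂ □̃`, the indicator `1_{□̃}` of M5.6). [cite: Balaban1985BackgroundPropagators, (3.95) p.411 («h_□ □̃ = h_□»), (3.87) p.409] -/
theorem chiBigT_mul_hB (t : BlkY i) : chiBigT i c t * hB i.D c t = hB i.D c t := by
  by_cases ht : hB i.D c t = 0
  · rw [ht, mul_zero]
  · obtain ⟨_, hMh2, hR, _⟩ := side_conditions i
    have hmem := QT_subset_QbigT (D := i.D) (one_le_Mh i) (four_le_P' i) c (mem_QT_of_hB_ne_zero i.D hMh2 hR (one_le_Mh i) (four_le_P' i) ht)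
    unfold chiBigT
    rw [if_pos hmem, one_mul]

/-- `|h_□| ≤ 1` on `𝔅`. [cite: Balaban1984PropagatorsII, (2.36) p.229, bookkeeping] -/
theorem abs_hB_le (t : BlkY i) : |hB i.D c t| ≤ 1 := abs_hB_le_one i.D (one_le_Mh i) (B9GeoLemma21KLevelV1.one_le_P i) c t


/-- `supp h_□ ⊂ J(N_□)` (E2-1's binder `hh`). [cite: Balaban1985BackgroundPropagators, (3.87) p.409, p.408, bookkeeping] -/
theorem exists_nearN_of_hB_ne_zero {t : BlkY i} (ht : hB i.D c t ≠ 0) : ∃ s ∈ nearN i c, s.1 = t.1 := by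
  obtain ⟨s, hs, e⟩ := exists_twinS_of_hB_ne_zero i c ht
  exact ⟨s, twinS_subset_nearN i c hs, e⟩

/-- `χ_□ = 1` on the sites of the blocks OUTSIDE `Z_χ := 𝔅_□ ∖ N_□` (FILE E2-5b-1's binder `hχZ`). [cite: Balaban1985BackgroundPropagators, Cor. 3.6 p.408, bookkeeping] -/
theorem chiY_eq_one_of_not_mem_sdiff {z : SiteY i} (h : blkCubeY i c z ∉ Finset.univ \ nearN i c) : chiY i c z = 1 :=
  chiY_eq_one_of_mem_nearN i c (by by_contra hn; exact h (Finset.mem_sdiff.2 ⟨Finset.mem_univ _, hn⟩))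

/-- `0 ≤ χ_□ ≤ 1`. [cite: Balaban1984PropagatorsI, (1.118) p.36; Balaban1985BackgroundPropagators, Cor. 3.6 p.408, bookkeeping] -/
theorem chiY_nonneg_le_one (z : SiteY i) : 0 ≤ chiY i c z ∧ chiY i c z ≤ 1 :=
  ⟨B9Cor36CutoffField337.bumpY_nonneg i _ _ z, B9Cor36CutoffField337.bumpY_le_one i _ _ z⟩

/-! ## §4 The walk lemma of the cube sequence and the separation `M_h ≤ d_□(S_□, ∁N_□)` -/

/-- **THE WALK LEMMA**: along a chain of admissible bonds of the cube sequence the torus positions of the end blocks are at most `|Γ|·L^{j+1}` apart (every block of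
`{Ω_n(□)}` has level `≤ j + 1`, and touching blocks have positions at most `L^{max level}` apart — N03's `dist_posT_le_of_adj`).
[cite: Balaban1984PropagatorsII, (2.46) p.231 («|Γʲ| the number of elements in Γʲ»); Balaban1985BackgroundPropagators, p.408 («{Ω_n(□)}_{n=0,…,j+1}»), p.411 («separated at least by a distance MLʲη»)] -/
theorem dist_posT_le_length_mul {a x : BlkCubeY i c} (p : (bondT (cubeFamY i c)).Walk a x) :
    dist (posT (cubeFamY i c) a) (posT (cubeFamY i c) x) ≤ (p.length : ℝ) * ((bS i c : ℕ) : ℝ) := by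
  induction p with
  | nil => simp
  | @cons a' b' e' h p ih =>
    have hab : dist (posT (cubeFamY i c) a') (posT (cubeFamY i c) b') ≤ ((bS i c : ℕ) : ℝ) := by
      refine (dist_posT_le_of_adj h).trans ?_
      exact_mod_cast Nat.pow_le_pow_right (by omega) (max_le (level_le i c a') (level_le i c b'))
    rw [SimpleGraph.Walk.length_cons]
    push_cast
    calc dist (posT (cubeFamY i c) a') (posT (cubeFamY i c) e')
        ≤ dist (posT (cubeFamY i c) a') (posT (cubeFamY i c) b') + dist (posT (cubeFamY i c) b') (posT (cubeFamY i c) e') := dist_triangle _ _ _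
      _ ≤ ((bS i c : ℕ) : ℝ) + (p.length : ℝ) * ((bS i c : ℕ) : ℝ) := add_le_add hab ih
      _ = ((p.length : ℝ) + 1) * ((bS i c : ℕ) : ℝ) := by ring

/-- hence the positions of two cube blocks are at most `d_□(s, y)·L^{j+1}` apart, `d_□` the (2.46) distance of the cube sequence (a shortest admissible contour exists,
N03's `connectedT`). [cite: Balaban1984PropagatorsII, (2.46) p.231; Balaban1985BackgroundPropagators, p.408] -/
theorem dist_posT_le_dist_mul (s y : BlkCubeY i c) :
    dist (posT (cubeFamY i c) s) (posT (cubeFamY i c) y) ≤ (geoCK i c).dist s y * ((bS i c : ℕ) : ℝ) := by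
  obtain ⟨p, hp⟩ := ((connectedT (D := cubeFamY i c) (toKT i).hMh (toKT i).hP).preconnected s y).exists_walk_length_eq_dist
  rw [geoCK_dist, ← hp]
  exact dist_posT_le_length_mul i c p

/-- the torus sup-distance of two SITES of two cube blocks is at most the distance of the blocks' positions plus `L^{j+1} − 1` (each site is within `(L^{n} − 1)/2` of its
block's position). [cite: Balaban1984PropagatorsII, (2.1) p.224, (2.46) p.231, bookkeeping] -/
theorem torusSupNorm_le_dist_posT_add {zs zy : SiteY i} {s y : BlkCubeY i c} (hs : blkCubeY i c zs = s) (hy : blkCubeY i c zy = y) :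
    torusSupNorm (toKT i).NB (zs.1 - zy.1) ≤ dist (posT (cubeFamY i c) s) (posT (cubeFamY i c) y) + (((bS i c : ℕ) : ℝ) - 1) := by
  have hN : ∀ μ, 1 ≤ (toKT i).NB μ := one_le_of_mem zs.2
  have h1 := dist_site_posT_le (D := cubeFamY i c) hs
  have h2 := dist_site_posT_le (D := cubeFamY i c) hy
  have hs' : (((ℓ + 1) ^ s.1.1 : ℕ) : ℝ) ≤ ((bS i c : ℕ) : ℝ) := by exact_mod_cast pow_level_le_bS i c s
  have hy' : (((ℓ + 1) ^ y.1.1 : ℕ) : ℝ) ≤ ((bS i c : ℕ) : ℝ) := by exact_mod_cast pow_level_le_bS i c y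
  rw [← dist_toT_toR hN]
  rw [dist_comm] at h2
  calc dist (toT (toKT i).NB (toR zs.1)) (toT (toKT i).NB (toR zy.1))
      ≤ dist (toT (toKT i).NB (toR zs.1)) (posT (cubeFamY i c) s) + dist (posT (cubeFamY i c) s) (posT (cubeFamY i c) y) +
          dist (posT (cubeFamY i c) y) (toT (toKT i).NB (toR zy.1)) := dist_triangle4 _ _ _ _
    _ ≤ dist (posT (cubeFamY i c) s) (posT (cubeFamY i c) y) + (((bS i c : ℕ) : ℝ) - 1) := by linarith

/-- **SEPARATION FROM THE RADII**: if a site of the cube block `s` is within `r₁` of the centre and a site of `y` is NOT within `r₂`, then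
`r₂ − r₁ − L^{j+1} + 2 ≤ d_□(s, y)·L^{j+1}`. [cite: Balaban1985BackgroundPropagators, p.411 («separated at least by a distance MLʲη»); Balaban1984PropagatorsII, (2.46) p.231, (2.83) p.237] -/
theorem sub_le_dist_mul_of_nearC {r₁ r₂ : ℤ} {zs zy : SiteY i} {s y : BlkCubeY i c} (hs : blkCubeY i c zs = s) (hy : blkCubeY i c zy = y)
    (h₁ : NearC i c r₁ zs.1) (h₂ : ¬ NearC i c r₂ zy.1) :
    ((r₂ - r₁ - (bS i c : ℤ) + 2 : ℤ) : ℝ) ≤ (geoCK i c).dist s y * ((bS i c : ℕ) : ℝ) := by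
  obtain ⟨μ, hμ⟩ : ∃ μ, r₂ < circAbs ((toKT i).NB μ) (zy.1 μ - B9CubeSequence408.ctrC c μ) := by
    by_contra h
    push Not at h
    exact h₂ fun μ => h μ
  have hN : 1 ≤ (toKT i).NB μ := one_le_of_mem zs.2 μ
  have t := circAbs_add_le hN (zy.1 μ - zs.1 μ) (zs.1 μ - B9CubeSequence408.ctrC c μ)
  rw [show zy.1 μ - zs.1 μ + (zs.1 μ - B9CubeSequence408.ctrC c μ) = zy.1 μ - B9CubeSequence408.ctrC c μ by ring] at t
  have hzs := h₁ μ
  have hk : r₂ + 1 - r₁ ≤ circAbs ((toKT i).NB μ) ((zs.1 - zy.1) μ) := by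
    rw [Pi.sub_apply, ← circAbs_neg hN, neg_sub]
    omega
  have hk' : ((r₂ + 1 - r₁ : ℤ) : ℝ) ≤ torusSupNorm (toKT i).NB (zs.1 - zy.1) :=
    le_trans (by exact_mod_cast hk) (B6BlockCutoffKLevelV1.circAbs_le_torusSupNorm' (toKT i).NB (zs.1 - zy.1) μ)
  have hD := torusSupNorm_le_dist_posT_add i c hs hy
  have hW := dist_posT_le_dist_mul i c s y
  push_cast at hk' ⊢
  linarith

/-- ★★ **THE SEPARATION OF THE TRUNCATION**: for `s ∈ S_□` and `y ∉ N_□`, `M_h ≤ d_□(s, y)` — «the supports of `h_□` and of `1 − □̃` are separated at least by a distance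
`MLʲη`» read for the record's sets (`S_j = M_h·L^{j+1}`, `2M_h − 2 + 2L^{−(j+1)} ≤ d_□` exactly).
[cite: Balaban1985BackgroundPropagators, p.411, p.412 l.31–36 («exp(−δM)»); Balaban1984PropagatorsII, (2.83) p.237, (2.46) p.231] -/
theorem Mh_le_dist_of_mem_twinS {s y : BlkCubeY i c} (hs : s ∈ twinS i c) (hy : y ∉ nearN i c) : ((toKT i).Mh : ℝ) ≤ (geoCK i c).dist s y := by
  obtain ⟨hs1, hne⟩ := (mem_twinS i c).1 hs
  have hzs : blkCubeY i c (rep i.D.toDomains ⟨s.1, hs1⟩) = s :=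
    (blkOf_eq_iff_of_val_eq i c (t := ⟨s.1, hs1⟩) (s := s) rfl _).1 (blkOf_rep i.D.toDomains _)
  have hz : B6Partition118KLevelTorus.hT (toKT i).D c (rep i.D.toDomains ⟨s.1, hs1⟩) ≠ 0 := hne
  have h₁ : NearC i c (SC i c) (rep i.D.toDomains ⟨s.1, hs1⟩).1 := nearC_of_hT_ne_zero i c hz
  have h₂ : ¬ NearC i c (3 * SC i c - (bS i c : ℤ)) (blkCornerCubeY i c y).1 := fun h => hy ((mem_nearN i c).2 h)
  have key := sub_le_dist_mul_of_nearC i c hzs (blkCubeY_corner i c y) h₁ h₂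
  have eSC : ((SC i c : ℤ) : ℝ) = ((toKT i).Mh : ℝ) * ((bS i c : ℕ) : ℝ) := by
    rw [SC_eq]; push_cast; ring
  have hb : (1 : ℝ) ≤ ((bS i c : ℕ) : ℝ) := by exact_mod_cast one_le_bS i c
  have hMh : (2 : ℝ) ≤ ((toKT i).Mh : ℝ) := by exact_mod_cast (side_conditions i).2.1
  push_cast at key
  rw [eSC] at key
  by_contra hlt
  push Not at hlt
  nlinarith [mul_lt_mul_of_pos_right hlt (lt_of_lt_of_le one_pos hb)]

/-- the same for `y ∈ Z_χ := 𝔅_□ ∖ N_□` (FILE E2-5b-1's binder `hDχ`). [cite: Balaban1985BackgroundPropagators, p.411, bookkeeping] -/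
theorem Mh_le_dist_of_mem_sdiff {s y : BlkCubeY i c} (hs : s ∈ twinS i c) (hy : y ∈ Finset.univ \ nearN i c) :
    ((toKT i).Mh : ℝ) ≤ (geoCK i c).dist s y :=
  Mh_le_dist_of_mem_twinS i c hs (Finset.mem_sdiff.1 hy).2

/-- the separation in M5.6's currency: `M_h = 2L·D_sep` (`D_sep = M/(2L²)`, `M = L·M_h`; FILE 10 `B9Thm39CinvAtCover.DsepT`). [cite: Balaban1985BackgroundPropagators, p.411; Balaban1984PropagatorsII, (2.83) p.237, bookkeeping] -/
theorem Mh_eq_DsepT : ((toKT i).Mh : ℝ) = 2 * ((ℓ : ℝ) + 1) * DsepT i := by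
  show ((i.Mh : ℕ) : ℝ) = 2 * ((ℓ : ℝ) + 1) * (1 / (2 * ((ℓ : ℝ) + 1) ^ 2) * (((ℓ : ℝ) + 1) * (i.Mh : ℝ)))
  have hL : (0 : ℝ) < (ℓ : ℝ) + 1 := by positivity
  field_simp

/-! ## §5 The transporter agreement on `N_□` from the (3.35) datum (p33's FILE 4 argument with a free row set) -/

section Agreement

variable {𝔸 : Type} [NormedRing 𝔸] [NormedAlgebra ℂ 𝔸] [CompleteSpace 𝔸]

/-- **AGREEMENT NEAR A ROW SET WITHIN `3S_j − L^{j+1}` IMPLIES `AgreeNearY`** (p33's `agreeNearY_DthY_of_near` with the row set `D_□` replaced by any `D` whose sites are within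
`3S_j − L^{j+1}` of the centre of `β`): if two configurations agree on every bond based within `3S_j + 1` (read through the chart), they agree in def-Y's `AgreeNearY` on
`D` — the bonds at `z`, `z − e_μ` (within `3S_j − L^{j+1} + 1`) and the rungs of the taxi runs inside the member block of `z` (level `≤ j + 1` near □, so within `3S_j − 1`).
[cite: Balaban1985BackgroundPropagators, p.410 l.14–15 («G′_□ depends on U restricted to Ω₀(□) ⊂ □̃⁵»), (3.40) p.397, (3.19) p.393] -/
theorem agreeNearY_of_nearC {W V : CfgY 𝔸 i}
    (hWV : ∀ (κ : Fin (d + 1)) (x : Site (B6GlobalChartV1.PV d ℓ i.m i.K hd hL) 0), NearC i c (3 * SC i c + 1) (B6GlobalChartV1.boxEquiv i.hN x).1 →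
      W κ x = V κ x)
    {D : Finset (SiteY i)} (hD : ∀ z ∈ D, NearC i c (3 * SC i c - (bS i c : ℤ)) z.1) :
    AgreeNearY i D W V := by
  have hS := one_le_SC i c
  have hb0 : (0 : ℤ) ≤ (bS i c : ℤ) := by positivity
  -- a torus point charting to within `r ≤ 3S + 1` is an agreement point
  have key : ∀ (κ : Fin (d + 1)) (z : SiteY i) {r : ℤ}, r ≤ 3 * SC i c + 1 → NearC i c r z.1 →
      W κ ((B6GlobalChartV1.boxEquiv i.hN).symm z) = V κ ((B6GlobalChartV1.boxEquiv i.hN).symm z) :=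
    fun κ z r hr hz => hWV κ _ (by rw [Equiv.apply_symm_apply]; exact hz.mono i c hr)
  -- the rungs of a taxi run between two sites of the member block of a row `z ∈ D` are agreement points
  have rung : ∀ {z : SiteY i}, z ∈ D → ∀ (a e : SiteY i), blkOf (toKT i).D.toDomains a = blkOf (toKT i).D.toDomains z →
      blkOf (toKT i).D.toDomains e = blkOf (toKT i).D.toDomains z → ∀ r ∈ taxiBondsY i a e, W r.2.1 r.1 = V r.2.1 r.1 := by
    intro z hz a e ha he r hr
    have hzD := hD z hz
    have hblk : blkOf (toKT i).D.toDomains (B6GlobalChartV1.toBox i.hN r.1) = blkOf (toKT i).D.toDomains z :=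
      B9Eq358TaxiLettersY.blkOf_toBox_rung_eq i (blkOf (toKT i).D.toDomains z) _ _ (fun μ => (B9Eq358TaxiLettersY.val_sub_corner i _ ha μ).2)
        (fun μ => (B9Eq358TaxiLettersY.val_sub_corner i _ he μ).2) r hr
    have h1 := nearC_of_blkOf_eq i c hblk.symm hzD
    have hlev := levY_le_succ_of_nearC i c (show 3 * SC i c - (bS i c : ℤ) ≤ 3 * SC i c by linarith) hzD
    have hp : (((ℓ + 1) ^ levY i z : ℕ) : ℤ) ≤ (bS i c : ℤ) := by exact_mod_cast Nat.pow_le_pow_right (by omega) hlev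
    rw [levY_eq_of_blkOf_eq i hblk] at h1
    have h2 : NearC i c (3 * SC i c + 1) (B6GlobalChartV1.toBox i.hN r.1).1 := h1.mono i c (by linarith)
    exact hWV r.2.1 r.1 (by rw [B6GlobalChartV1.boxEquiv_apply]; exact h2)
  refine ⟨fun z hz μ => ?_, fun z hz w hw => ?_⟩
  · have hzD := hD z hz
    exact ⟨key μ z (by linarith) hzD, key μ _ (by linarith) (nearC_shiftY_symm i c hzD μ)⟩
  · have hb : blkOf (toKT i).D.toDomains w = blkOf (toKT i).D.toDomains z := by
      rw [B9Thm311DeltaPrimeSymm.avgCoeffY_eq_ite] at hw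
      by_contra hne; exact hw (if_neg hne)
    have hc : blkOf (toKT i).D.toDomains (Node00.cornerY i (levY i z) z) = blkOf (toKT i).D.toDomains z := by
      rw [B9Thm311DeltaPrimeSymm.cornerY_levY_eq]
      exact B6Geom246MultiLevelBox.blkOf_corner _ _
    exact ⟨⟨rung hz _ _ rfl hc, rung hz _ _ hc rfl⟩, ⟨rung hz _ _ hc hb, rung hz _ _ hb hc⟩⟩

/-- **`AgreeNearY` ON SUCH A ROW SET FOR `U^u` AND `Ṽ_□ = e^{iηχ̃_□A}`** from the (3.35) datum: `U^u = e^{iηA}` on every bond with both ends in `Q ⊇` the torus points within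
`3S_j + 2`, and `χ̃_□ = 1` within `3.75S_j` (p33's `agreeNearY_DthY_locCfgY`, free row set). [cite: Balaban1985BackgroundPropagators, Cor. 3.6 p.408, p.410 l.14–15, p.409 l.1–3] -/
theorem agreeNearY_locCfgY_of_nearC {W : CfgY 𝔸 i} {Q : Set (Site (B6GlobalChartV1.PV d ℓ i.m i.K hd hL) 0)} (η : ℝ) (A : B9Eq360DeltaPrimeAY.AfldY 𝔸 i)
    (hQ : ∀ x : Site (B6GlobalChartV1.PV d ℓ i.m i.K hd hL) 0, NearC i c (3 * SC i c + 2) (B6GlobalChartV1.boxEquiv i.hN x).1 → x ∈ Q)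
    (hWA : ∀ (κ : Fin (d + 1)) (x : Site (B6GlobalChartV1.PV d ℓ i.m i.K hd hL) 0), x ∈ Q → x.shift κ ∈ Q →
      W κ x = B9Eq39Adjoint.fluct η A κ x)
    {D : Finset (SiteY i)} (hD : ∀ z ∈ D, NearC i c (3 * SC i c - (bS i c : ℤ)) z.1) :
    AgreeNearY i D W (locCfgY i c η A) := by
  refine agreeNearY_of_nearC i c (fun κ x hx => ?_) hD
  have hS := nine_le_SC i c
  have h1 : chiTY i c (B6GlobalChartV1.boxEquiv i.hN x) = 1 := chiTY_eq_one_of_nearC i c (by omega) hx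
  rw [locCfgY_apply, fluct_cutFldY_of_eq_one i η A h1]
  refine hWA κ x (hQ x (hx.mono i c (by linarith))) (hQ _ ?_)
  have e : B6GlobalChartV1.boxEquiv i.hN (x.shift κ) = Node00.shiftY i κ (B6GlobalChartV1.boxEquiv i.hN x) := by
    apply (B6GlobalChartV1.boxEquiv i.hN).symm.injective
    rw [Node00.boxEquiv_symm_shiftY, Equiv.symm_apply_apply, Equiv.symm_apply_apply]
  rw [e]
  exact B9Cor36CubeCutoffs.nearC_shiftY i c hx κ

/-- ★★ **FILE E2-1's `hagree` ON `N_□` FROM THE (3.35) DATUM**: the averaging transporters of `U^u` and of `Ṽ_□` at def-Y's `parSymY` agree on every block of `N_□`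
(E2-1's `parS_agree_of_agreeNearY` at the row set of the corners of `N_□`). [cite: Balaban1985BackgroundPropagators, (3.21) p.394, Cor. 3.6 p.408, p.410 l.14–15] -/
theorem parSymY_agree_of_mem_nearN (g : GaugeY 𝔸 i) (U : CfgY 𝔸 i) {Q : Set (Site (B6GlobalChartV1.PV d ℓ i.m i.K hd hL) 0)} (η : ℝ)
    (A : B9Eq360DeltaPrimeAY.AfldY 𝔸 i)
    (hQ : ∀ x : Site (B6GlobalChartV1.PV d ℓ i.m i.K hd hL) 0, NearC i c (3 * SC i c + 2) (B6GlobalChartV1.boxEquiv i.hN x).1 → x ∈ Q)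
    (hgA : ∀ (κ : Fin (d + 1)) (x : Site (B6GlobalChartV1.PV d ℓ i.m i.K hd hL) 0), x ∈ Q → x.shift κ ∈ Q →
      gaugeY i g U κ x = B9Eq39Adjoint.fluct η A κ x) :
    ∀ s ∈ nearN i c, ∀ w, B6Geom246MultiLevelBoxL0.blkOf (cubeFamY i c).toDomains w = s →
      parSymY i (gaugeY i g U) (blkCornerCubeY i c s) w = parSymY i (locCfgY i c η A) (blkCornerCubeY i c s) w := by
  classical
  refine B9Cor36CinvCubeLocLetter.parS_agree_of_agreeNearY i c (parLocalY_parSymY i) (D := (nearN i c).image (blkCornerCubeY i c))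
    (agreeNearY_locCfgY_of_nearC i c η A hQ hgA fun z hz => ?_) (nearN i c) (fun s hs => val_mem_of_mem_nearN i c hs) fun s hs => ?_
  · obtain ⟨y, hy, rfl⟩ := Finset.mem_image.1 hz
    exact (mem_nearN i c).1 hy
  · exact ⟨blkCornerCubeY i c s, Finset.mem_image_of_mem _ hs, blkCubeY_corner i c s⟩

end Agreement

end Literature.MathematicalPhysics.QuantumFieldTheory.Balaban1983to89.B9Cor36CubeTwinsGeometry

end
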